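import Literature.MathematicalPhysics.QuantumFieldTheory.Balaban1983to89.T4HaarSU2Translate
import Literature.MathematicalPhysics.QuantumFieldTheory.Balaban1983to89.T4TriangularPushforward
import Literature.MathematicalPhysics.QuantumFieldTheory.Balaban1983to89.T4FiniteEpsInhabited

/-!
# `HaarAC` for Bałaban's block averaging (0.4) with the quaternionic projected mean on `SU(2)`

`T4FiniteEpsInhabited` reduced the INHABITATION of Bałaban's finite-`ε` data type on `SU(2)` with the print-faithful block
averaging `BlockAveraging.blockAvg su2Mean` ((0.4) of [Balaban1987RG1] p. 253, with the quaternionic projected mean of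
`BlockAveragingSU2` as the small-loop average) to ONE measure-theoretic residual, `HaarAC`: the push-forward of product Haar
measure on `T^{(j)}` under the averaging function `Ū = M(U, ·) : T^{(j)} → T^{(j+1)}` is absolutely continuous with respect
to product Haar measure on `T^{(j+1)}` (`T4FiniteEpsInhabited.exists_isBlockAveraged_su2Mean_of_haarAC`).  This module
PROVES that residual (`haarAC_avgFun_su2Mean`) and draws the corollary (`exists_isBlockAveraged_su2Mean`).

## The argument

Two elementary facts about the loop words `Γ ∪ [x,x′] ∪ (−Γ′) ∪ (−c)` of (0.4) (staircases from block centres, offsets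
`|n_ν| ≤ (L-1)/2`, `L` odd) in the standing range `j + 1 ≤ m + K` (no wrap-around):

* **(A) private coordinates.** The CENTRAL CROSSING BOND `β(c) = ⟨emb c₋ + ((L-1)/2) e_μ, μ⟩` of the straight line of `c`
  (`centralBond`) is traversed by NO staircase (`ne_centralBond_of_mem_walk_stairWord`: staircase bonds have longitudinal
  source offset `≢ (L-1)/2 (mod L)`), and by a transported segment `[x, x′]` at `c′` only if `c′ = c` and `x` lies ON the
  line of `c` (`central_of_mem_walk_openWord`); in particular `β(c)` occurs in the loops and the line of `c′` only for
  `c′ = c` (`eq_of_mem_walk_loopWord_of_eq_centralBond`).  Hence `Ū(c′)` does not depend on `U(β(c))` for `c′ ≠ c`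
  (`isLocal_avgFun`, for EVERY small-loop average `ℰ` and every group), and `β` is injective (`centralBond_injective`).
* **(B) central loops backtrack.** For `x` on the line of `c` the staircase is a single run along `μ`, so
  `U(Γ ∪ [x,x′] ∪ (−Γ′)) = U(c)` (`holAt_walk_openWord_of_forall_ne`; `U(c)` = the straight-line transporter `axialAvg`),
  while for `x` off the line the open holonomy does not see `U(β(c))` at all (`openHol_update_of_not_isCentral`); and
  `U(c) = pre · U(β(c)) · post` with `pre`, `post` free of `U(β(c))` (`axialAvg_update_centralBond`).

On `SU(2)`, since the loop variables are `V_i · U(c)⁻¹` (`loopHol_eq_openHol_mul`) and the projected mean is two-sidedly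
equivariant ((0.6), `BlockAveragingSU2.mean_mul_mul`), on the small-field domain `Ū(c) = mean(V)` (`avgFun_eq_mean_openHol`)
and, as a function of the private coordinate `g = U(β(c))` alone, `Ū(c) = pre · translateProj a g · post` with a `g`-free
quaternion shift `a` (`avgFun_update_of_small`); off the small-field domain `Ū(c) = pre · g · post`.  Both one-variable
laws are absolutely continuous (`T4HaarSU2Translate.haarData_map_mul_translateProj_mul_absolutelyContinuous`), hence so is
their measurable splice (`T4TriangularPushforward.absolutelyContinuous_map_of_forall_eq_or`), and the TRIANGULAR
PUSH-FORWARD LEMMA `T4TriangularPushforward.map_pi_absolutelyContinuous_pi` (locality (A) + injectivity of `β` +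
conditional absolute continuity) gives `HaarAC` (`haarAC_avgFun_su2Mean_of_le`).

## What this is NOT

The corollary `exists_isBlockAveraged_su2Mean` inhabits the CARRIER `FiniteEpsData F SU(2)` with data averaging by (0.4);
the inhabitant is the stub of `T4FiniteEpsInhabited` §3 (placeholder `Realisation`), at which the pinned end statement (B)
of the cell FAILS (`T4FiniteEpsInhabited.not_endStatementBPrinted_of_stubData`).  Nothing here is progress on the
continuum limit (Theorems 1–2 of [Balaban1987RG1]) or on the summit; every result is elementary lattice combinatorics and
measure theory ([folklore]) about the published formula (0.4).

## Versions

* v1 (p180143): the module.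
* v1.1 (docstring-only; every declaration byte-identical to v1): the cite tag of `exists_blockAvgSU2_rp_and_cov` named
  `Thm 2 p.259` of [Balaban1987RG1] as source although neither it nor its source lemma
  `BlockAveragingSU2.limit_rp_and_cov_of_blockAvgSU2` uses Theorem 2 (referee objection G-ref2-22 (c)); the tag now names
  what is used, (0.4) p. 253 (with (0.6) p. 253 and `HaarAC`).  No cite tag of this module names Theorem 2 any more.
-/

noncomputable section

open MeasureTheory Function
open scoped Quaternion

namespace Literature.MathematicalPhysics.QuantumFieldTheory.Balaban1983to89

namespace BlockAveragingHaarAC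

open T4Continuum AveragingRT BlockAveraging
open T4ReflectionCone (netDisp_append netDisp_replicate holAt_congr)

/-! ## 1. Bonds of lattice walks: prefix decomposition, reversed walks, straight runs -/

section Walks

variable {P : Params} {j : ℕ}

/-- The letter spelled by a step of a walk occurs in the word. [folklore] -/
theorem letter_mem_of_mem_walk : ∀ (x : Site P j) (w : List (Letter P.d)) (s : LStep P j), s ∈ walk x w →
    (s.bond.dir, s.fwd) ∈ w
  | _, [], s, hs => by simp [walk] at hs
  | x, (μ, true) :: w, s, hs => by
    simp only [walk, List.mem_cons] at hs
    rcases hs with rfl | hs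
    · simp
    · exact List.mem_cons_of_mem _ (letter_mem_of_mem_walk _ _ s hs)
  | x, (μ, false) :: w, s, hs => by
    simp only [walk, List.mem_cons] at hs
    rcases hs with rfl | hs
    · simp
    · exact List.mem_cons_of_mem _ (letter_mem_of_mem_walk _ _ s hs)

/-- BOTH ENDPOINTS OF EVERY BOND OF A WALK ARE ENDS OF PREFIXES: the source of the bond is the base displaced by the net
displacement of some prefix, and another prefix is displaced from it by `+e_{dir}`. [folklore] -/
theorem exists_take_of_mem_walk : ∀ (x : Site P j) (w : List (Letter P.d)) (s : LStep P j), s ∈ walk x w →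
    ∃ k₁ k₂ : ℕ, (∀ ν, s.bond.src ν = x ν + ((netDisp (w.take k₁) ν : ℤ) : ZMod (P.sitesPerDir j))) ∧
      ∀ ν, netDisp (w.take k₂) ν = netDisp (w.take k₁) ν + if ν = s.bond.dir then 1 else 0
  | _, [], s, hs => by simp [walk] at hs
  | x, (μ, true) :: w, s, hs => by
    simp only [walk, List.mem_cons] at hs
    rcases hs with rfl | hs
    · refine ⟨0, 1, fun ν => by simp, fun ν => ?_⟩
      simp only [List.take_succ_cons, List.take_zero, netDisp_cons, netDisp_nil']
      by_cases h : ν = μ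
      · subst h; simp
      · simp [h, Ne.symm h]
    · obtain ⟨k₁, k₂, h1, h2⟩ := exists_take_of_mem_walk (x.shift μ) w s hs
      refine ⟨k₁ + 1, k₂ + 1, fun ν => ?_, fun ν => ?_⟩
      · rw [h1 ν, List.take_succ_cons, netDisp_cons, Site.shift_apply]
        by_cases h : ν = μ
        · subst h; simp only [if_true]; push_cast; ring
        · simp [h, Ne.symm h]
      · rw [List.take_succ_cons, List.take_succ_cons, netDisp_cons, netDisp_cons, h2 ν]
        ring
  | x, (μ, false) :: w, s, hs => by
    simp only [walk, List.mem_cons] at hs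
    rcases hs with rfl | hs
    · refine ⟨1, 0, fun ν => ?_, fun ν => ?_⟩
      · simp only [List.take_succ_cons, List.take_zero, netDisp_cons, netDisp_nil', Site.unshift_apply]
        by_cases h : ν = μ
        · subst h; simp only [if_true]; push_cast; ring
        · simp [h, Ne.symm h]
      · simp only [List.take_succ_cons, List.take_zero, netDisp_cons, netDisp_nil']
        by_cases h : ν = μ
        · subst h; simp
        · simp [h, Ne.symm h]
    · obtain ⟨k₁, k₂, h1, h2⟩ := exists_take_of_mem_walk (x.unshift μ) w s hs
      refine ⟨k₁ + 1, k₂ + 1, fun ν => ?_, fun ν => ?_⟩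
      · rw [h1 ν, List.take_succ_cons, netDisp_cons, Site.unshift_apply]
        by_cases h : ν = μ
        · subst h; simp only [if_true, Bool.false_eq_true, if_false]; push_cast; ring
        · simp [h, Ne.symm h]
      · rw [List.take_succ_cons, List.take_succ_cons, netDisp_cons, netDisp_cons, h2 ν]
        ring

/-- THE BONDS OF THE REVERSED WALK ARE THE BONDS OF THE WALK (traversed the other way). [folklore] -/
theorem flip_mem_walk_of_mem_walk_wordRev : ∀ (x : Site P j) (w : List (Letter P.d)) (s : LStep P j),
    s ∈ walk (walkEnd x w) (wordRev w) → (⟨s.bond, !s.fwd⟩ : LStep P j) ∈ walk x w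
  | _, [], s, hs => by simp [walk] at hs
  | x, (μ, true) :: w, s, hs => by
    rw [wordRev_cons] at hs
    simp only [walkEnd] at hs
    rw [walk_append, walkEnd_walkEnd_wordRev, List.mem_append] at hs
    simp only [walk, List.mem_cons]
    rcases hs with hs | hs
    · exact Or.inr (flip_mem_walk_of_mem_walk_wordRev (x.shift μ) w s hs)
    · left
      simp only [Letter.flip, Bool.not_true, walk, List.mem_singleton, Site.unshift_shift] at hs
      subst hs
      simp
  | x, (μ, false) :: w, s, hs => by
    rw [wordRev_cons] at hs
    simp only [walkEnd] at hs
    rw [walk_append, walkEnd_walkEnd_wordRev, List.mem_append] at hs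
    simp only [walk, List.mem_cons]
    rcases hs with hs | hs
    · exact Or.inr (flip_mem_walk_of_mem_walk_wordRev (x.unshift μ) w s hs)
    · left
      simp only [Letter.flip, Bool.not_false, walk, List.mem_singleton] at hs
      subst hs
      simp

/-- The bonds of a straight run of `t` steps `+e_μ` from `x`: `⟨x + t′ e_μ, μ⟩`, `t′ < t`, traversed forward. [folklore] -/
theorem mem_walk_replicate {x : Site P j} {μ : Fin P.d} {t : ℕ} {s : LStep P j}
    (hs : s ∈ walk x (List.replicate t (μ, true))) :
    s.bond.dir = μ ∧ s.fwd = true ∧ ∃ t' : ℕ, t' < t ∧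
      ∀ ν, s.bond.src ν = x ν + (((if ν = μ then (t' : ℤ) else 0 : ℤ)) : ZMod (P.sitesPerDir j)) := by
  have hl := letter_mem_of_mem_walk x _ s hs
  rw [List.mem_replicate, Prod.mk.injEq] at hl
  obtain ⟨-, hd, hf⟩ := hl
  refine ⟨hd, hf, ?_⟩
  obtain ⟨k₁, k₂, h1, h2⟩ := exists_take_of_mem_walk x _ s hs
  have h2μ := h2 μ
  rw [if_pos hd.symm, netDisp_take_replicate, netDisp_take_replicate] at h2μ
  simp only [if_true, mul_one] at h2μ
  have hk₂ : (min k₂ t : ℕ) ≤ t := min_le_right _ _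
  refine ⟨min k₁ t, by omega, fun ν => ?_⟩
  rw [h1 ν, netDisp_take_replicate]
  by_cases hν : ν = μ
  · subst hν; simp
  · simp [hν, Ne.symm hν]

/-! ### congruences of the centred labelling (standing range `j + 1 ≤ m + K`) -/

/-- The `t`-th line site in coordinates: `emb c₋ + t e_μ`. [folklore] -/
theorem lineSite_apply_int (c : PBond P (j+1)) (t : ℕ) (ν : Fin P.d) :
    lineSite c t ν = emb c.src ν + (((if ν = c.dir then (t : ℤ) else 0 : ℤ)) : ZMod (P.sitesPerDir j)) := by
  unfold lineSite
  by_cases h : ν = c.dir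
  · subst h; simp
  · simp [h]

/-- `emb y ν + r = emb y′ ν + r′ (mod 2L^{m+K-j})` forces `r ≡ r′ (mod L)` (`L` divides the site count). [folklore] -/
theorem L_dvd_of_emb_add_eq (hj : j + 1 ≤ P.m + P.K) {y y' : Site P (j+1)} {ν : Fin P.d} {r r' : ℤ}
    (h : emb y ν + (r : ZMod (P.sitesPerDir j)) = emb y' ν + (r' : ZMod (P.sitesPerDir j))) :
    (P.L : ℤ) ∣ r' - r := by
  set hh : ℕ := (P.L - 1) / 2 with hdef
  have key : (((((y ν).val * P.L + hh : ℕ) : ℤ) + r : ℤ) : ZMod (P.sitesPerDir j)) =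
      (((((y' ν).val * P.L + hh : ℕ) : ℤ) + r' : ℤ) : ZMod (P.sitesPerDir j)) := by
    simpa only [emb, ← hdef, Int.cast_add, Int.cast_natCast] using h
  rw [ZMod.intCast_eq_intCast_iff_dvd_sub, P.sitesPerDir_eq_mul_succ hj] at key
  have hL : (P.L : ℤ) ∣ ((P.sitesPerDir (j + 1) * P.L : ℕ) : ℤ) := ⟨P.sitesPerDir (j + 1), by push_cast; ring⟩
  have h3 := hL.trans key
  have e : (((y' ν).val * P.L + hh : ℕ) : ℤ) + r' - ((((y ν).val * P.L + hh : ℕ) : ℤ) + r) =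
      (P.L : ℤ) * (((y' ν).val : ℤ) - ((y ν).val : ℤ)) + (r' - r) := by push_cast; ring
  rw [e] at h3
  exact (dvd_add_right (dvd_mul_right _ _)).mp h3

/-- `emb y ν = emb y′ ν` forces `y ν = y′ ν` (no wrap-around in the standing range). [folklore] -/
theorem apply_eq_of_emb_apply_eq (hj : j + 1 ≤ P.m + P.K) {y y' : Site P (j+1)} {ν : Fin P.d} (h : emb y ν = emb y' ν) :
    y ν = y' ν := by
  have hv := congrArg ZMod.val h
  rw [Site.val_emb hj, Site.val_emb hj] at hv
  exact ZMod.val_injective _ (Nat.eq_of_mul_eq_mul_right P.L_pos (by omega))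

/-- `emb y ν + r = emb y′ ν + r` forces `y ν = y′ ν`. [folklore] -/
theorem apply_eq_of_emb_add_eq (hj : j + 1 ≤ P.m + P.K) {y y' : Site P (j+1)} {ν : Fin P.d} {r : ℤ}
    (h : emb y ν + (r : ZMod (P.sitesPerDir j)) = emb y' ν + (r : ZMod (P.sitesPerDir j))) : y ν = y' ν :=
  apply_eq_of_emb_apply_eq hj (add_right_cancel h)

/-- An integer divisible by `L` and strictly between `-L` and `L` is `0`. [folklore] -/
theorem eq_zero_of_L_dvd {r : ℤ} (h : (P.L : ℤ) ∣ r) (h1 : -(P.L : ℤ) < r) (h2 : r < P.L) : r = 0 :=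
  Int.eq_zero_of_abs_lt_dvd h (abs_lt.mpr ⟨h1, h2⟩)

/-! ### the central crossing bond of a coarse bond and where it can occur -/

/-- **THE CENTRAL CROSSING BOND `β(c)`** of the coarse bond `c = ⟨y, y + e_μ⟩`: the middle bond
`⟨emb y + ((L-1)/2) e_μ, μ⟩` of the straight line of `c` — the fine bond joining the block `B(c₋)` to the block `B(c₊)`
along the line (its source has offset `L - 1` in direction `μ` and `(L-1)/2` transversally). It is the PRIVATE INPUT
COORDINATE of the output coordinate `c` of the block averaging (`isLocal_avgFun`). [folklore] -/
def centralBond (c : PBond P (j+1)) : PBond P j := line c ((P.L - 1) / 2)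

/-- `β` is injective (standing range). [folklore] -/
theorem centralBond_injective (hj : j + 1 ≤ P.m + P.K) : Injective (centralBond : PBond P (j+1) → PBond P j) := by
  intro c c' h
  have hd : (centralBond c).dir = (centralBond c').dir := congrArg PBond.dir h
  have hs : (centralBond c).src = (centralBond c').src := congrArg PBond.src h
  change c.dir = c'.dir at hd
  change lineSite c ((P.L - 1) / 2) = lineSite c' ((P.L - 1) / 2) at hs
  have hy : c.src = c'.src := by
    funext ν
    have hν := congrFun hs ν
    rw [lineSite_apply_int, lineSite_apply_int, ← hd] at hν
    exact apply_eq_of_emb_add_eq hj hν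
  cases c; cases c'
  simp only at hd hy
  subst hd; subst hy; rfl

/-- NO STAIRCASE BOND IS A CENTRAL CROSSING BOND: along a staircase `Γ ∈ G(y, x)` from a block centre (offsets `|n_ν| ≤ (L-1)/2`)
every bond has longitudinal source offset `≤ L - 2` in its own direction. [folklore] -/
theorem ne_centralBond_of_mem_walk_stairWord (hj : j + 1 ≤ P.m + P.K) (c : PBond P (j+1)) (y : Site P (j+1))
    (σ : Equiv.Perm (Fin P.d)) (n : Fin P.d → ℤ)
    (hn : ∀ κ, -(((P.L - 1) / 2 : ℕ) : ℤ) ≤ n κ ∧ n κ ≤ (((P.L - 1) / 2 : ℕ) : ℤ))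
    {s : LStep P j} (hs : s ∈ walk (emb y) (stairWord σ n)) : s.bond ≠ centralBond c := by
  intro hsc
  obtain ⟨k₁, k₂, h1, h2⟩ := exists_take_of_mem_walk _ _ s hs
  have hb1 := netDisp_take_stairWord σ n c.dir k₁
  have hb2 := netDisp_take_stairWord σ n c.dir k₂
  have hnd := hn c.dir
  have hdir : s.bond.dir = c.dir := by rw [hsc]; rfl
  have h2d := h2 c.dir
  rw [if_pos hdir.symm] at h2d
  have hsrc : s.bond.src c.dir = lineSite c ((P.L - 1) / 2) c.dir := by rw [hsc]; rfl
  rw [h1 c.dir, lineSite_apply_int, if_pos rfl] at hsrc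
  have hdvd := L_dvd_of_emb_add_eq hj hsrc
  have hL := two_mul_half_add_one P
  have h0 := eq_zero_of_L_dvd hdvd (by omega) (by omega)
  omega

/-- WHERE A TRANSPORTED BOND CAN BE CENTRAL: if a bond of the straight run of `L` steps `+e_μ` from `x = emb y + n`
(`|n_ν| ≤ (L-1)/2`) is the central crossing bond of `c`, then `c = ⟨y, y + e_μ⟩` and `n` is longitudinal (`n_ν = 0` for
`ν ≠ μ`). [folklore] -/
theorem eq_of_mem_walk_replicate_of_eq_centralBond (hj : j + 1 ≤ P.m + P.K) (c : PBond P (j+1)) (y : Site P (j+1))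
    (μ : Fin P.d) (n : Fin P.d → ℤ)
    (hn : ∀ κ, -(((P.L - 1) / 2 : ℕ) : ℤ) ≤ n κ ∧ n κ ≤ (((P.L - 1) / 2 : ℕ) : ℤ))
    {x : Site P j} (hx : ∀ ν, x ν = emb y ν + ((n ν : ℤ) : ZMod (P.sitesPerDir j)))
    {s : LStep P j} (hs : s ∈ walk x (List.replicate P.L (μ, true))) (hsc : s.bond = centralBond c) :
    c = ⟨y, μ⟩ ∧ ∀ ν, ν ≠ μ → n ν = 0 := by
  obtain ⟨hd, -, t', ht', hsrc⟩ := mem_walk_replicate hs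
  have hdir : c.dir = μ := by rw [← hd, hsc]; rfl
  have hL := two_mul_half_add_one P
  have key : ∀ ν, emb y ν + (((n ν + if ν = μ then (t' : ℤ) else 0 : ℤ)) : ZMod (P.sitesPerDir j)) =
      emb c.src ν + (((if ν = μ then (((P.L - 1) / 2 : ℕ) : ℤ) else 0 : ℤ)) : ZMod (P.sitesPerDir j)) := by
    intro ν
    have h1 := hsrc ν
    rw [hsc] at h1
    change lineSite c _ ν = _ at h1
    rw [lineSite_apply_int, hx ν, hdir] at h1
    rw [h1]; push_cast; ring
  have hn0 : ∀ ν, ν ≠ μ → n ν = 0 := by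
    intro ν hν
    have h1 := L_dvd_of_emb_add_eq hj (key ν)
    rw [if_neg hν, if_neg hν] at h1
    have hnν := hn ν
    have h0 := eq_zero_of_L_dvd h1 (by omega) (by omega)
    omega
  have hnμ : n μ + t' = (((P.L - 1) / 2 : ℕ) : ℤ) := by
    have h1 := L_dvd_of_emb_add_eq hj (key μ)
    rw [if_pos rfl, if_pos rfl] at h1
    have hnν := hn μ
    have h0 := eq_zero_of_L_dvd h1 (by omega) (by omega)
    omega
  have hy : y = c.src := by
    funext ν
    have kν := key ν
    by_cases hν : ν = μ
    · subst hν
      rw [if_pos rfl, if_pos rfl, hnμ] at kν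
      exact apply_eq_of_emb_add_eq hj kν
    · rw [if_neg hν, if_neg hν, hn0 ν hν, add_zero] at kν
      exact apply_eq_of_emb_add_eq hj kν
  refine ⟨?_, hn0⟩
  cases c
  simp only at hdir hy
  subst hy; subst hdir; rfl

/-- On the straight line of `c` the only central crossing bond is `β(c)` itself: if a line bond of `c` is `β(c′)` then
`c′ = c`. [folklore] -/
theorem eq_of_mem_walk_line_of_eq_centralBond (hj : j + 1 ≤ P.m + P.K) (c c' : PBond P (j+1)) {s : LStep P j}
    (hs : s ∈ walk (emb c.src) (List.replicate P.L (c.dir, true))) (hsc : s.bond = centralBond c') : c' = c := by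
  have hL := two_mul_half_add_one P
  have h := eq_of_mem_walk_replicate_of_eq_centralBond hj c' c.src c.dir (fun _ => 0)
    (fun κ => by constructor <;> omega) (x := emb c.src) (fun ν => by simp) hs hsc
  rw [h.1]

/-- THE OPEN PART `Γ ∪ [x,x′] ∪ (−Γ′)` of the loop word of (0.4) (the loop word is this followed by `−c`).
[cite: Balaban1987RG1, (0.4) p.253] -/
def openWord {d : ℕ} (L : ℕ) (μ : Fin d) (n : Fin d → ℤ) (σ σ' : Equiv.Perm (Fin d)) : List (Letter d) :=
  stairWord σ n ++ (List.replicate L (μ, true) ++ wordRev (stairWord σ' n))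

/-- `loopWord = openWord ++ (−c)`. [folklore] -/
theorem loopWord_eq_openWord_append {d : ℕ} (L : ℕ) (μ : Fin d) (n : Fin d → ℤ) (σ σ' : Equiv.Perm (Fin d)) :
    loopWord L μ n σ σ' = openWord L μ n σ σ' ++ List.replicate L (μ, false) := by
  simp only [loopWord, openWord, List.append_assoc]

/-- The open part ends where the straight line ends (`emb y + L e_μ`). [folklore] -/
theorem walkEnd_openWord (x : Site P j) (μ : Fin P.d) (n : Fin P.d → ℤ) (σ σ' : Equiv.Perm (Fin P.d)) :
    walkEnd x (openWord P.L μ n σ σ') = walkEnd x (List.replicate P.L (μ, true)) := by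
  funext ν
  rw [walkEnd_apply, walkEnd_apply]
  congr 2
  simp only [openWord, netDisp_append, netDisp_wordRev, netDisp_stairWord]
  ring

/-- `−c` is the reverse of the straight line word. [folklore] -/
theorem replicate_false_eq_wordRev {d : ℕ} (L : ℕ) (μ : Fin d) :
    List.replicate L (μ, false) = wordRev (List.replicate L (μ, true)) := by
  rw [wordRev_replicate]; rfl

/-- The reverse of a backward run is the forward run. [folklore] -/
theorem wordRev_replicate_false {d : ℕ} (L : ℕ) (μ : Fin d) :
    wordRev (List.replicate L (μ, false)) = List.replicate L (μ, true) := by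
  rw [wordRev_replicate]; rfl

/-- **FACT (A), OPEN PART.** If a bond of `Γ ∪ [x,x′] ∪ (−Γ′)` at `c` (index `(r, σ, σ′)`) is the central crossing bond of
`c′`, then `c′ = c` and the index is CENTRAL (`n_ν = 0` for `ν ≠ μ`): the bond is on the transported segment `[x,x′]`
with `x` on the line of `c`. [folklore] -/
theorem central_of_mem_walk_openWord (hj : j + 1 ≤ P.m + P.K) (c c' : PBond P (j+1)) (r : Fin P.d → Fin P.L)
    (σ σ' : Equiv.Perm (Fin P.d)) {s : LStep P j} (hs : s ∈ walk (emb c.src) (openWord P.L c.dir (off r) σ σ'))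
    (hsc : s.bond = centralBond c') : c' = c ∧ ∀ ν, ν ≠ c.dir → off r ν = 0 := by
  have hn := off_bounds r
  unfold openWord at hs
  rw [walk_append, List.mem_append, walk_append, List.mem_append] at hs
  rcases hs with hs | hs | hs
  · exact absurd hsc (ne_centralBond_of_mem_walk_stairWord hj c' c.src σ (off r) hn hs)
  · have hx : ∀ ν, walkEnd (emb c.src) (stairWord σ (off r)) ν = emb c.src ν + ((off r ν : ℤ) : ZMod (P.sitesPerDir j)) :=
      fun ν => by rw [walkEnd_apply, netDisp_stairWord]
    obtain ⟨hc, h0⟩ := eq_of_mem_walk_replicate_of_eq_centralBond hj c' c.src c.dir (off r) hn hx hs hsc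
    exact ⟨by rw [hc], h0⟩
  · have hstart : walkEnd (walkEnd (emb c.src) (stairWord σ (off r))) (List.replicate P.L (c.dir, true)) =
        walkEnd (emb c.tgt) (stairWord σ' (off r)) := by
      funext ν
      rw [walkEnd_apply, walkEnd_apply, walkEnd_apply, PBond.tgt, emb_shift_apply, netDisp_stairWord, netDisp_stairWord,
        netDisp_replicate]
      by_cases hν : ν = c.dir
      · subst hν; simp only [if_true, mul_one]; push_cast; ring
      · simp [hν, Ne.symm hν]
    rw [hstart] at hs
    exact absurd hsc (ne_centralBond_of_mem_walk_stairWord hj c' c.tgt σ' (off r) hn (s := ⟨s.bond, !s.fwd⟩)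
      (flip_mem_walk_of_mem_walk_wordRev _ _ s hs))

/-- **FACT (A).** The central crossing bond `β(c′)` is a bond of a loop `Γ ∪ [x,x′] ∪ (−Γ′) ∪ (−c)` at `c` only if
`c′ = c`. [folklore] -/
theorem eq_of_mem_walk_loopWord_of_eq_centralBond (hj : j + 1 ≤ P.m + P.K) (c c' : PBond P (j+1)) (i : Idx P)
    {s : LStep P j} (hs : s ∈ walk (emb c.src) (loopWord P.L c.dir (off i.1) i.2.1 i.2.2))
    (hsc : s.bond = centralBond c') : c' = c := by
  rw [loopWord_eq_openWord_append, walk_append, List.mem_append] at hs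
  rcases hs with hs | hs
  · exact (central_of_mem_walk_openWord hj c c' i.1 i.2.1 i.2.2 hs hsc).1
  · rw [walkEnd_openWord, replicate_false_eq_wordRev] at hs
    exact eq_of_mem_walk_line_of_eq_centralBond hj c c' (flip_mem_walk_of_mem_walk_wordRev _ _ s hs) hsc

end Walks

/-! ## 2. Locality of the block averaging in the private coordinates `β` (FACT (A)) -/

section Locality

variable {P : Params} {j : ℕ} {G : Type*} [GaugeGroup G] [DecidableEq (PBond P j)]

/-- The loop variables at `c′ ≠ c` do not see `U(β(c))`. [folklore] -/
theorem loopHol_update_centralBond (hj : j + 1 ≤ P.m + P.K) (U : GaugeField P j G) (c c' : PBond P (j+1)) (hc : c' ≠ c)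
    (g : G) : loopHol (update U (centralBond c) g) c' = loopHol U c' := by
  funext i
  unfold loopHol
  refine holAt_congr fun s hs => update_of_ne ?_ _ _
  intro hsc
  exact hc (eq_of_mem_walk_loopWord_of_eq_centralBond hj c' c i hs hsc).symm

/-- The coarse bond variable `U(c′)` (`axialAvg`), `c′ ≠ c`, does not see `U(β(c))`. [folklore] -/
theorem axialAvg_update_centralBond_of_ne (hj : j + 1 ≤ P.m + P.K) (U : GaugeField P j G) (c c' : PBond P (j+1))
    (hc : c' ≠ c) (g : G) : axialAvg (update U (centralBond c) g) c' = axialAvg U c' := by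
  rw [axialAvg_eq_holAt_walk, axialAvg_eq_holAt_walk]
  refine holAt_congr fun s hs => update_of_ne ?_ _ _
  intro hsc
  exact hc (eq_of_mem_walk_line_of_eq_centralBond hj c' c hs hsc).symm

/-- **LOCALITY OF THE BLOCK AVERAGING (0.4) IN THE PRIVATE COORDINATES `β`** (`T4TriangularPushforward.IsLocal`): the output
`Ū(c′)` does not depend on the input `U(β(c))` for `c ≠ c′` — for every small-loop average `ℰ`. [folklore] -/
theorem isLocal_avgFun (hj : j + 1 ≤ P.m + P.K) (ℰ : LoopAverage G) :
    T4TriangularPushforward.IsLocal (centralBond : PBond P (j+1) → PBond P j)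
      (avgFun ℰ : GaugeField P j G → GaugeField P (j+1) G) := by
  intro U c g c' hc
  show corr ℰ (update U (centralBond c) g) c' * axialAvg (update U (centralBond c) g) c' = corr ℰ U c' * axialAvg U c'
  have h1 : corr ℰ (update U (centralBond c) g) c' = corr ℰ U c' := by
    unfold corr BlockAveraging.Small
    rw [loopHol_update_centralBond hj U c c' hc g]
  rw [h1, axialAvg_update_centralBond_of_ne hj U c c' hc g]

end Locality

/-! ## 3. Central loops backtrack (FACT (B)); the one-variable normal form of `Ū(c)` in `U(β(c))` -/

section Words

variable {d : ℕ}

/-- A staircase all of whose offsets but `n_μ` vanish is the single run along `μ`. [folklore] -/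
theorem stairRuns_eq_of_forall_ne (n : Fin d → ℤ) (μ : Fin d) (hn : ∀ ν, ν ≠ μ → n ν = 0) :
    ∀ as : List (Fin d), as.Nodup → stairRuns n as = if μ ∈ as then axisRun μ (n μ) else []
  | [], _ => by simp [stairRuns]
  | a :: as, h => by
    rw [List.nodup_cons] at h
    rw [stairRuns, stairRuns_eq_of_forall_ne n μ hn as h.2]
    by_cases ha : a = μ
    · subst ha
      simp [h.1]
    · have h0 : axisRun a (n a) = [] := by rw [hn a ha]; simp [axisRun]
      rw [h0, List.nil_append]
      simp [Ne.symm ha]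

/-- The staircase word of a longitudinal offset is a single run. [folklore] -/
theorem stairWord_eq_axisRun_of_forall_ne (σ : Equiv.Perm (Fin d)) (n : Fin d → ℤ) (μ : Fin d)
    (hn : ∀ ν, ν ≠ μ → n ν = 0) : stairWord σ n = axisRun μ (n μ) := by
  rw [stairWord, stairRuns_eq_of_forall_ne n μ hn _ (nodup_finRange_map σ), if_pos (mem_finRange_map σ μ)]

end Words

section NormalForm

variable {P : Params} {j : ℕ} {G : Type*} [GaugeGroup G]

/-- **FACT (B): CENTRAL LOOPS BACKTRACK.** For a longitudinal offset the open part `Γ ∪ [x,x′] ∪ (−Γ′)` has the holonomy of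
the straight line of `c` (the runs cancel: `U(Γ)U(Γ)⁻¹`). [folklore] -/
theorem holAt_walk_openWord_of_forall_ne (U : GaugeField P j G) (y : Site P (j+1)) (μ : Fin P.d) (n : Fin P.d → ℤ)
    (σ σ' : Equiv.Perm (Fin P.d)) (hn : ∀ ν, ν ≠ μ → n ν = 0) :
    holAt U (walk (emb y) (openWord P.L μ n σ σ')) = holAt U (walk (emb y) (List.replicate P.L (μ, true))) := by
  unfold openWord
  rw [stairWord_eq_axisRun_of_forall_ne σ n μ hn, stairWord_eq_axisRun_of_forall_ne σ' n μ hn]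
  rcases le_or_gt 0 (n μ) with h0 | h0
  · have hrun : axisRun μ (n μ) = List.replicate (n μ).natAbs (μ, true) := by simp [axisRun, h0]
    rw [hrun]
    set t := (n μ).natAbs
    have hw : List.replicate t ((μ, true) : Letter P.d) ++ (List.replicate P.L (μ, true) ++
        wordRev (List.replicate t (μ, true))) =
        List.replicate P.L (μ, true) ++ (List.replicate t (μ, true) ++ wordRev (List.replicate t (μ, true))) := by
      rw [← List.append_assoc, List.replicate_append_replicate, add_comm, ← List.replicate_append_replicate,
        List.append_assoc]
    rw [hw, walk_append, holAt_append, walk_append, holAt_append, holAt_walk_wordRev, mul_inv_cancel, mul_one]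
  · have hrun : axisRun μ (n μ) = List.replicate (n μ).natAbs (μ, false) := by simp [axisRun, not_le.mpr h0]
    rw [hrun, wordRev_replicate_false]
    set t := (n μ).natAbs
    have hw : List.replicate P.L ((μ, true) : Letter P.d) ++ List.replicate t (μ, true) =
        List.replicate t (μ, true) ++ List.replicate P.L (μ, true) := by
      rw [List.replicate_append_replicate, List.replicate_append_replicate, add_comm]
    rw [hw, walk_append, holAt_append, walk_append, holAt_append]
    set x₂ := walkEnd (emb y) (List.replicate t (μ, false)) with hx₂
    have hend : walkEnd x₂ (List.replicate t (μ, true)) = emb y := by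
      have h := walkEnd_walkEnd_wordRev (emb y) (List.replicate t ((μ, false) : Letter P.d))
      rwa [wordRev_replicate_false] at h
    have hfirst : holAt U (walk (emb y) (List.replicate t (μ, false))) =
        (holAt U (walk x₂ (List.replicate t (μ, true))))⁻¹ := by
      have h := holAt_walk_wordRev U x₂ (List.replicate t ((μ, true) : Letter P.d))
      rwa [hend, ← replicate_false_eq_wordRev] at h
    rw [hfirst, hend, inv_mul_cancel_left]

/-- **THE OPEN HOLONOMIES `V_i(U) = U(Γ ∪ [x,x′] ∪ (−Γ′))`** at `c`, index `i = (r, σ, σ′)`.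
[cite: Balaban1987RG1, (0.4) p.253] -/
def openHol (U : GaugeField P j G) (c : PBond P (j+1)) (i : Idx P) : G :=
  holAt U (walk (emb c.src) (openWord P.L c.dir (off i.1) i.2.1 i.2.2))

/-- The loop variables of (0.4) factor as `V_i · U(c)⁻¹` (`U(c)` = the straight-line transporter `axialAvg`). [folklore] -/
theorem loopHol_eq_openHol_mul (U : GaugeField P j G) (c : PBond P (j+1)) (i : Idx P) :
    loopHol U c i = openHol U c i * (axialAvg U c)⁻¹ := by
  unfold loopHol openHol
  rw [loopWord_eq_openWord_append, walk_append, holAt_append, walkEnd_openWord, replicate_false_eq_wordRev,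
    holAt_walk_wordRev, ← axialAvg_eq_holAt_walk]

/-- The CENTRAL indices at `c`: longitudinal offsets (`x` on the straight line of `c`). [folklore] -/
def IsCentral (c : PBond P (j+1)) (i : Idx P) : Prop := ∀ ν, ν ≠ c.dir → off i.1 ν = 0

/-- Centrality of an index is decidable. [folklore] -/
instance (c : PBond P (j+1)) : DecidablePred (IsCentral c) := fun i => by
  unfold IsCentral; infer_instance

/-- FACT (B) for the open holonomies: `V_i = U(c)` at central indices. [folklore] -/
theorem openHol_of_isCentral (U : GaugeField P j G) (c : PBond P (j+1)) (i : Idx P) (h : IsCentral c i) :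
    openHol U c i = axialAvg U c := by
  unfold openHol
  rw [holAt_walk_openWord_of_forall_ne U c.src c.dir (off i.1) _ _ h, axialAvg_eq_holAt_walk]

/-- FACT (A) for the open holonomies: at non-central indices `V_i` does not see `U(β(c))`. [folklore] -/
theorem openHol_update_of_not_isCentral [DecidableEq (PBond P j)] (hj : j + 1 ≤ P.m + P.K) (U : GaugeField P j G)
    (c : PBond P (j+1)) (i : Idx P) (h : ¬ IsCentral c i) (g : G) : openHol (update U (centralBond c) g) c i = openHol U c i := by
  unfold openHol
  refine holAt_congr fun s hs => update_of_ne ?_ _ _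
  intro hsc
  exact h (central_of_mem_walk_openWord hj c c i.1 _ _ hs hsc).2

/-- Transport along the first half `t < (L-1)/2` of the line of `c`. [folklore] -/
def pre (U : GaugeField P j G) (c : PBond P (j+1)) : G :=
  holAt U (walk (emb c.src) (List.replicate ((P.L - 1) / 2) (c.dir, true)))

/-- Transport along the second half `(L-1)/2 < t < L` of the line of `c`. [folklore] -/
def post (U : GaugeField P j G) (c : PBond P (j+1)) : G :=
  holAt U (walk (lineSite c ((P.L - 1) / 2 + 1)) (List.replicate ((P.L - 1) / 2) (c.dir, true)))

/-- `U(c) = pre · U(β(c)) · post`. [folklore] -/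
theorem axialAvg_eq_pre_mul_mul_post (U : GaugeField P j G) (c : PBond P (j+1)) :
    axialAvg U c = pre U c * U (centralBond c) * post U c := by
  rw [axialAvg_eq_holAt_walk]
  have hsplit : List.replicate P.L ((c.dir, true) : Letter P.d) =
      List.replicate ((P.L - 1) / 2) (c.dir, true) ++ ((c.dir, true) :: List.replicate ((P.L - 1) / 2) (c.dir, true)) := by
    rw [← List.replicate_succ, List.replicate_append_replicate]
    congr 1
    have := two_mul_half_add_one P
    omega
  rw [hsplit, walk_append, holAt_append, walkEnd_replicate_line]
  simp only [walk, holAt_cons, if_true]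
  rw [← lineSite_succ, mul_assoc]
  rfl

/-- `pre` does not see `U(β(c))`. [folklore] -/
theorem pre_update [DecidableEq (PBond P j)] (hj : j + 1 ≤ P.m + P.K) (U : GaugeField P j G) (c : PBond P (j+1))
    (g : G) : pre (update U (centralBond c) g) c = pre U c := by
  unfold pre
  refine holAt_congr fun s hs => update_of_ne ?_ _ _
  intro hsc
  obtain ⟨-, -, t', ht', hsrc⟩ := mem_walk_replicate hs
  have h1 := hsrc c.dir
  rw [hsc, if_pos rfl] at h1
  change lineSite c _ c.dir = _ at h1
  rw [lineSite_apply_int, if_pos rfl] at h1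
  have hd := L_dvd_of_emb_add_eq hj h1
  have hL := two_mul_half_add_one P
  have h0 := eq_zero_of_L_dvd hd (by omega) (by omega)
  omega

/-- `post` does not see `U(β(c))`. [folklore] -/
theorem post_update [DecidableEq (PBond P j)] (hj : j + 1 ≤ P.m + P.K) (U : GaugeField P j G) (c : PBond P (j+1))
    (g : G) : post (update U (centralBond c) g) c = post U c := by
  unfold post
  refine holAt_congr fun s hs => update_of_ne ?_ _ _
  intro hsc
  obtain ⟨-, -, t', ht', hsrc⟩ := mem_walk_replicate hs
  have h1 := hsrc c.dir
  rw [hsc, if_pos rfl, lineSite_apply_int, if_pos rfl] at h1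
  change lineSite c _ c.dir = _ at h1
  rw [lineSite_apply_int, if_pos rfl, add_assoc, ← Int.cast_add] at h1
  have hd := L_dvd_of_emb_add_eq hj h1
  have hL := two_mul_half_add_one P
  have h0 := eq_zero_of_L_dvd hd (by push_cast; omega) (by push_cast; omega)
  push_cast at h0
  omega

/-- **THE COARSE BOND VARIABLE IS AFFINE IN THE PRIVATE COORDINATE**: `U′(c) = pre · g · post` for `U′ = U[β(c) ↦ g]`,
with `pre`, `post` independent of `g`. [folklore] -/
theorem axialAvg_update_centralBond [DecidableEq (PBond P j)] (hj : j + 1 ≤ P.m + P.K) (U : GaugeField P j G)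
    (c : PBond P (j+1)) (g : G) : axialAvg (update U (centralBond c) g) c = pre U c * g * post U c := by
  rw [axialAvg_eq_pre_mul_mul_post, pre_update hj, post_update hj, update_self]

/-- Off the small-field domain the block averaging is the axial one. [folklore] -/
theorem avgFun_of_not_small (ℰ : LoopAverage G) (U : GaugeField P j G) (c : PBond P (j+1)) (hS : ¬ Small ℰ U c) :
    avgFun ℰ U c = axialAvg U c := by
  show corr ℰ U c * axialAvg U c = axialAvg U c
  unfold corr
  rw [if_neg hS, one_mul]

end NormalForm

/-! ## 4. `SU(2)`: the one-variable law of `Ū(c)` in `U(β(c))` and `HaarAC` -/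

section SU2

open SU2Mean T4HaarSU2Translate T4TriangularPushforward
open Literature.MathematicalPhysics.QuantumLattice (quatMatrix det_quatMatrix su2Quat su2Quat_ne_zero quatToSU2
  quatToSU2_smul)

variable {P : Params} {j : ℕ}

/-- The projected mean is invariant under reindexing along a bijection of index types. [folklore] -/
theorem mean_comp_equiv {ι ι' : Type*} [Fintype ι] [Fintype ι'] (W : ι → Matrix.specialUnitaryGroup (Fin 2) ℂ)
    (e : ι' ≃ ι) : mean (W ∘ e) = mean W := by
  apply Subtype.ext
  rw [coe_mean, coe_mean]
  congr 1
  exact Equiv.sum_comp e (fun i => (W i : Matrix (Fin 2) (Fin 2) ℂ))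

/-- `det V = 1` for `V ∈ SU(2)`. [folklore] -/
theorem det_coe_eq_one (A : Matrix.specialUnitaryGroup (Fin 2) ℂ) : (A : Matrix (Fin 2) (Fin 2) ℂ).det = 1 :=
  (Matrix.mem_specialUnitaryGroup_iff.1 A.2).2

/-- The loop family of (0.4) is the two-sided translate `1 · V · U(c)⁻¹` of the open family. [folklore] -/
theorem loopHol_eq (U : GaugeField P j (Matrix.specialUnitaryGroup (Fin 2) ℂ)) (c : PBond P (j+1)) :
    loopHol U c = fun i => (1 : Matrix.specialUnitaryGroup (Fin 2) ℂ) * openHol U c i * (axialAvg U c)⁻¹ :=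
  funext fun i => by rw [one_mul, loopHol_eq_openHol_mul]

/-- On the small-field domain the Euclidean sum of the open family is non-degenerate. [folklore] -/
theorem det_qsum_openHol_ne_zero (U : GaugeField P j (Matrix.specialUnitaryGroup (Fin 2) ℂ)) (c : PBond P (j+1))
    (hS : Small su2Mean U c) : (qsum (openHol U c)).det ≠ 0 := by
  have h1 : (qsum (loopHol U c)).det ≠ 0 :=
    det_qsum_ne_zero_of_dist1_lt_one _ (fun i => by simpa using hS i)
  rw [loopHol_eq, qsum_mul_mul, Matrix.det_mul, Matrix.det_mul, det_coe_eq_one, det_coe_eq_one, one_mul,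
    mul_one] at h1
  exact h1

/-- **`Ū(c) = mean(V)` ON THE SMALL-FIELD DOMAIN**: the factor `U(c)⁻¹` of the loop variables cancels against the coarse
bond variable `U(c)` of (0.4) ((0.6) two-sided, `BlockAveragingSU2.mean_mul_mul`). [folklore] -/
theorem avgFun_eq_mean_openHol (U : GaugeField P j (Matrix.specialUnitaryGroup (Fin 2) ℂ)) (c : PBond P (j+1))
    (hS : Small su2Mean U c) : avgFun su2Mean U c = mean (openHol U c) := by
  show corr su2Mean U c * axialAvg U c = mean (openHol U c)
  unfold corr
  rw [if_pos hS]
  show su2Mean.E (loopHol U c ∘ (LoopAverage.enum (Idx P)).symm) * axialAvg U c = mean (openHol U c)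
  rw [su2Mean_E, mean_comp_equiv, loopHol_eq, mean_mul_mul _ _ _ (det_qsum_openHol_ne_zero U c hS), one_mul,
    inv_mul_cancel_right]

/-- The number `N_c ≥ 1` of central indices. [folklore] -/
def nCentral (c : PBond P (j+1)) : ℕ := (Finset.univ.filter (IsCentral c)).card

/-- `N_c ≥ 1` (the index `((L-1)/2, …, (L-1)/2; 1, 1)` is central). [folklore] -/
theorem nCentral_pos (c : PBond P (j+1)) : 0 < nCentral c :=
  Finset.card_pos.mpr ⟨(fun _ => ⟨(P.L - 1) / 2, half_lt P⟩, 1, 1), by simp [IsCentral, off]⟩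

/-- The quaternion sum of the open holonomies over the NON-central indices (independent of `U(β(c))`). [folklore] -/
def offSum (U : GaugeField P j (Matrix.specialUnitaryGroup (Fin 2) ℂ)) (c : PBond P (j+1)) : ℍ :=
  ∑ i ∈ Finset.univ.filter (fun i => ¬ IsCentral c i), su2Quat (openHol U c i)

/-- The quaternion barycentre of the open family of `U′ = U[β(c) ↦ g]`: `N_c · (p̂ ĝ q̂) + B` with `p̂, q̂, B` free of
`g`. [folklore] -/
theorem sum_su2Quat_openHol_update [DecidableEq (PBond P j)] (hj : j + 1 ≤ P.m + P.K)
    (U : GaugeField P j (Matrix.specialUnitaryGroup (Fin 2) ℂ)) (c : PBond P (j+1)) (g : Matrix.specialUnitaryGroup (Fin 2) ℂ) :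
    ∑ i, su2Quat (openHol (update U (centralBond c) g) c i) =
      (nCentral c : ℝ) • su2Quat (pre U c * g * post U c) + offSum U c := by
  rw [← Finset.sum_filter_add_sum_filter_not Finset.univ (IsCentral c)]
  congr 1
  · rw [Finset.sum_congr rfl (fun i hi => by
        rw [openHol_of_isCentral _ c i (Finset.mem_filter.1 hi).2, axialAvg_update_centralBond hj]),
      Finset.sum_const, ← Nat.cast_smul_eq_nsmul ℝ]
    rfl
  · unfold offSum
    exact Finset.sum_congr rfl fun i hi => by
      rw [openHol_update_of_not_isCentral hj U c i (Finset.mem_filter.1 hi).2 g]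

/-- The `g`-free quaternion shift `a = N_c⁻¹ · p̂⁻¹ B q̂⁻¹` of the one-variable normal form. [folklore] -/
def aShift (U : GaugeField P j (Matrix.specialUnitaryGroup (Fin 2) ℂ)) (c : PBond P (j+1)) : ℍ :=
  ((nCentral c : ℝ))⁻¹ • ((su2Quat (pre U c))⁻¹ * offSum U c * (su2Quat (post U c))⁻¹)

/-- **THE ONE-VARIABLE NORMAL FORM ON THE SMALL-FIELD DOMAIN**: as a function of its private coordinate `g = U(β(c))`, all
other bond variables fixed, `Ū(c) = pre · translateProj a g · post` — the translate-and-project map of `T4HaarSU2Translate`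
between two fixed group elements. [folklore] -/
theorem avgFun_update_of_small [DecidableEq (PBond P j)] (hj : j + 1 ≤ P.m + P.K)
    (U : GaugeField P j (Matrix.specialUnitaryGroup (Fin 2) ℂ)) (c : PBond P (j+1)) (g : Matrix.specialUnitaryGroup (Fin 2) ℂ)
    (hS : Small su2Mean (update U (centralBond c) g) c) :
    avgFun su2Mean (update U (centralBond c) g) c = pre U c * translateProj (aShift U c) g * post U c := by
  have hdet := det_qsum_openHol_ne_zero _ c hS
  rw [avgFun_eq_mean_openHol _ c hS]
  apply Subtype.ext
  rw [coe_mean, qsum_eq_quatMatrix, sum_su2Quat_openHol_update hj, su2Quat_mul, su2Quat_mul]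
  rw [qsum_eq_quatMatrix, sum_su2Quat_openHol_update hj, su2Quat_mul, su2Quat_mul, det_quatMatrix] at hdet
  have hp0 : su2Quat (pre U c) ≠ 0 := su2Quat_ne_zero _
  have hq0 : su2Quat (post U c) ≠ 0 := su2Quat_ne_zero _
  have hN : (0 : ℝ) < nCentral c := by exact_mod_cast nCentral_pos c
  have hfac : (nCentral c : ℝ) • (su2Quat (pre U c) * su2Quat g * su2Quat (post U c)) + offSum U c =
      su2Quat (pre U c) * ((nCentral c : ℝ) • su2Quat g +
        (su2Quat (pre U c))⁻¹ * offSum U c * (su2Quat (post U c))⁻¹) * su2Quat (post U c) := by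
    rw [mul_add, add_mul, mul_smul_comm, smul_mul_assoc]
    congr 1
    rw [← mul_assoc, ← mul_assoc, mul_inv_cancel₀ hp0, one_mul, mul_assoc, inv_mul_cancel₀ hq0, mul_one]
  have hX0 : (nCentral c : ℝ) • su2Quat g + (su2Quat (pre U c))⁻¹ * offSum U c * (su2Quat (post U c))⁻¹ ≠ 0 := by
    intro h0
    apply hdet
    rw [hfac, h0, mul_zero, zero_mul, map_zero, Complex.ofReal_zero]
  rw [hfac, projMat_quatMatrix, ← mul_quatToSU2_mul _ _ hX0, translateProj_apply, aShift,
    ← quatToSU2_smul hN (su2Quat g + _), smul_add, smul_inv_smul₀ hN.ne']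

/-- **THE ONE-VARIABLE LAWS OF (0.4) ARE ABSOLUTELY CONTINUOUS**: for every configuration `U` off `β(c)` the law of
`Ū(c)` under Haar measure in the private coordinate `U(β(c))` is absolutely continuous (on the small-field domain the
translate-and-project law of `T4HaarSU2Translate`, off it a two-sided Haar translate). [folklore] -/
theorem map_haar_avgFun_update_absolutelyContinuous [DecidableEq (PBond P j)] (hj : j + 1 ≤ P.m + P.K)
    (U : GaugeField P j (Matrix.specialUnitaryGroup (Fin 2) ℂ)) (c : PBond P (j+1)) :
    (HaarData.haar : Measure (Matrix.specialUnitaryGroup (Fin 2) ℂ)).map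
        (fun g => avgFun su2Mean (update U (centralBond c) g) c) ≪ HaarData.haar := by
  refine absolutelyContinuous_map_of_forall_eq_or (f₁ := fun g => pre U c * translateProj (aShift U c) g * post U c)
    (f₂ := fun g => pre U c * translateProj 0 g * post U c) ?_ (measurable_mul_translateProj_mul _ _ _)
    (measurable_mul_translateProj_mul _ _ _) (fun g => ?_)
    (haarData_map_mul_translateProj_mul_absolutelyContinuous _ _ _)
    (haarData_map_mul_translateProj_mul_absolutelyContinuous _ _ _)
  · exact (measurable_pi_apply c).comp ((measurable_avgFun su2Mean measurable_su2Mean_E).comp (measurable_update U))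
  · by_cases hS : Small su2Mean (update U (centralBond c) g) c
    · exact Or.inl (avgFun_update_of_small hj U c g hS)
    · right
      show avgFun su2Mean (update U (centralBond c) g) c = pre U c * translateProj 0 g * post U c
      rw [avgFun_of_not_small _ _ _ hS, axialAvg_update_centralBond hj, translateProj_zero]

/-- **`HaarAC` FOR BAŁABAN'S BLOCK AVERAGING (0.4) WITH THE QUATERNIONIC PROJECTED MEAN ON `SU(2)`**, on every torus in the
standing range `j + 1 ≤ m + K`: the push-forward of product Haar measure under `Ū = M(U, ·)` is absolutely continuous
with respect to product Haar measure — by the triangular push-forward lemma of `T4TriangularPushforward` in the private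
coordinates `β(c)` = the central crossing bonds. [folklore] -/
theorem haarAC_avgFun_su2Mean_of_le (hj : j + 1 ≤ P.m + P.K) :
    T4FiniteEpsInhabited.HaarAC (avgFun su2Mean :
      GaugeField P j (Matrix.specialUnitaryGroup (Fin 2) ℂ) → GaugeField P (j+1) (Matrix.specialUnitaryGroup (Fin 2) ℂ)) := by
  classical
  unfold T4FiniteEpsInhabited.HaarAC fieldMeasure
  exact map_pi_absolutelyContinuous_pi (HaarData.haar : Measure (Matrix.specialUnitaryGroup (Fin 2) ℂ))
    (isLocal_avgFun hj su2Mean) (centralBond_injective hj) (measurable_avgFun su2Mean measurable_su2Mean_E)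
    (fun U c => map_haar_avgFun_update_absolutelyContinuous hj U c)

/-- **ROW T4-D.G FOR `su2Mean`: `HaarAC` ON EVERY TORUS OF A FAMILY** in the standing range `k < K` — the hypothesis of
`T4FiniteEpsInhabited.exists_isBlockAveraged_su2Mean_of_haarAC`. [folklore] -/
theorem haarAC_avgFun_su2Mean (F : T4Family) (K k : ℕ) (hk : k < K) :
    T4FiniteEpsInhabited.HaarAC (avgFun su2Mean :
      GaugeField (F.P K) k (Matrix.specialUnitaryGroup (Fin 2) ℂ) →
        GaugeField (F.P K) (k + 1) (Matrix.specialUnitaryGroup (Fin 2) ℂ)) :=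
  haarAC_avgFun_su2Mean_of_le (by show k + 1 ≤ F.m + K; omega)

/-- **BLOCK-AVERAGED FINITE-`ε` DATA ON `SU(2)` EXIST**: `∃ D : FiniteEpsData F SU(2), D.IsBlockAveraged su2Mean` — the
measure-theoretic residual of `T4FiniteEpsInhabited` ("THE RESIDUAL") discharged. The inhabitant is the STUB of
`T4FiniteEpsInhabited` §3 (placeholder `Realisation`), at which the pinned end statement (B) FAILS
(`T4FiniteEpsInhabited.not_endStatementBPrinted_of_stubData`): carrier inhabitation, not the theorem.
[cite: Balaban1987RG1, (0.4) p.253] -/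
theorem exists_isBlockAveraged_su2Mean (F : T4Family) :
    ∃ D : T4Continuum.FiniteEpsData F (Matrix.specialUnitaryGroup (Fin 2) ℂ), D.IsBlockAveraged su2Mean :=
  T4FiniteEpsInhabited.exists_isBlockAveraged_su2Mean_of_haarAC F (fun K k hk => haarAC_avgFun_su2Mean F K k hk)

/-- Hence finite-`ε` data on `SU(2)` averaging by (0.4) with the projected mean EXIST and satisfy the reflection-positivity
and torus-covariance targets in both forms (`BlockAveragingSU2.limit_rp_and_cov_of_blockAvgSU2`).  What is USED is the
block-averaging formula (0.4) and the two-sided equivariance (0.6) of [Balaban1987RG1] p. 253 together with `HaarAC`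
(this module); Theorem 2 of [Balaban1987RG1] (p. 259, the flow-control theorem — stated 1987, proved nowhere in print
per the cell's census, MISSING.md item A1) is NOT used by this declaration or anywhere in this module, and the inhabitant
is the STUB at which (B) fails (v1.1: tag corrected from `Thm 2 p.259`, referee objection G-ref2-22 (c)).
[cite: Balaban1987RG1, (0.4) p.253] -/
theorem exists_blockAvgSU2_rp_and_cov (F : T4Family) :
    ∃ D : T4Continuum.FiniteEpsData F (Matrix.specialUnitaryGroup (Fin 2) ℂ), D.IsBlockAveraged su2Mean ∧
      (D.limit_reflectionPositive' ∧ D.limit_reflectionPositive) ∧ (D.limit_torusCovariant' ∧ D.limit_torusCovariant) := by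
  obtain ⟨D, hD⟩ := exists_isBlockAveraged_su2Mean F
  exact ⟨D, hD, D.limit_rp_and_cov_of_blockAvgSU2 hD⟩

end SU2

end BlockAveragingHaarAC

end Literature.MathematicalPhysics.QuantumFieldTheory.Balaban1983to89

end
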